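/-
Copyright: statement-level skeleton of a published paper (lit-balaban cell, Phase-2 proof seat p19, gen 4). No claims beyond
what the kernel checks below.
-/
import Mathlib
import Literature.MathematicalPhysics.QuantumFieldTheory.Balaban1983to89.B3Prop21Instance

/-!
# B3 — T. Bałaban, *(Higgs)₂,₃ quantum fields in a finite volume. III. Renormalization*, CMP **88** (1983) 411–445
[Balaban1983Higgs3] — Proposition 2.1 p. 424 with the constant O(1) UNIFORM over all graphs of bounded size (*"The constant
O(1) depends on α₀, n̄"*, p. 421): r15's `B3Prop1.Prop21` INHABITED for the multi-graph expansions of the amplitude model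

statement-level skeleton of published theorems with citation tags; proofs where landed; nothing here is a claim about
the Yang–Mills mass gap

PDF held: `paper:balaban1983-higgs-2-3-quantum-fields-finite-volume` (journal page = PDF page + 410); displays read on
the ×2 renders `pub-balaban/b2b-balaban-ref1/pages/1983-cmp88-higgs23-III/1983-cmp88-higgs23-III-p010, p011, p014 … p018-x2.png`
(pp. 420–421, 424–428).

Part of the Phase-2 work on SKELETON rows **B3.Prop2.1 / B3.Prop2.2** (unit `lit-balaban-p19` gen 4, HOME
`run/shared/lean/pub/lit-balaban/`), continuing `B3Prop21Model` / `B3Prop21Instance` (gen 3: Proposition 2.1 for the family of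
localized lattice graph amplitudes over ONE count datum, constant per datum).  The owner's head decision (ROWS-B3 v1.32) records
two residual scope clauses of that instance: (a) *"O(1) depends on n̄ only"* was rendered as "depends on the count datum"; (b) the
(2.4) exception is not modelled.  THIS FILE removes (a).  (The (2.4) exception — integration by parts (2.8)/(2.9) p. 425 — is the
subject of the companion files of this seat.)

WHAT IS REPRODUCED.  Proposition 1 / 2.1 pp. 420–421, 424 [PDF 10–11, 14], verbatim: *"The constant δ₀ depends on the dimension d
only … The constant O(1) depends on α₀, n̄ (in fact on n̄ only if α₀ is chosen not too close to 0, e.g. if we take α₀ = ½), and is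
independent of ε, k, the domains Ω, Ω₁, Ω₂, the vector field B̃"*; (2.15) p. 427: *"where O(1) is a constant depending on n̄ and δ₁
only"*.  KERNEL-CHECKED HERE, for the amplitude model of `B3Ineq213Amplitude` (Proposition 2.2 generality):
* the degrees (2.2) of the blocks are HALF-INTEGERS (`two_mul_degQ_eq_intCast`: the leg dimensions `−(d−2)/2`, the
  differentiations `−1`, the averaged legs `+1` and the vertex powers `d + e_v` are halves of integers), hence *"positive degree"*
  means `D ≥ ½` (`half_le_degQ_of_pos`, `half_le_D_of_pos`) and `Σ_α D(G_{i+1}^{(α)}) ≥ ½` (`half_le_Dsum_succ`);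
* consequently the constant of (2.15) is bounded UNIFORMLY over all count data with `m` lines and lattice constants `d`, `L`, `δ₁`:
  `const215(G) ≤ unifConst215 d L m δ₁ = Π_{i<m} e^{½δ₁}K(½δ₁/(2m+1)^{i+1}, d) · ((1 − L^{−1/2})^{−1})^m` (`const215_le_unifConst215`) — the
  printed *"O(1) depending on n̄ and δ₁ only"*;
* the MULTI-GRAPH EXPANSION `expansionAll P mb D` of r15's carrier `B3Prop1.GraphExpansion`: ONE expansion per analytic datum `D`
  (`Datum P`: the number `k` of completed steps, the running couplings `e(L^kε) > 0`, `λ(L^kε) > 0`, and for every count datum an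
  amplitude of the class `Amp` at these values with kernel constants `≤ Cmax` — the model's rendering of the datum *"ε, k, the
  domains Ω, Ω₁, Ω₂, the vector field B̃"*), whose graphs are ALL count data on the vertex sets `Fin n` (every `n`) with at most `mb`
  lines and the lattice constants of `P` (`CGraph P mb`); `E(G, {□(v)}, Φ, A)` = the total amplitude of `G` at the unit cubes
  `{□(v)}`, `d({□(v)})` = `boxTreeLen`, norms / orders / connected subgraphs (components of the `G_i` along every ordering) /
  degrees as in `B3Prop21Instance.expansionOf`, `Is24 := False`;
* **`prop21_uniform : B3Prop1.Prop21 (famAll P mbar)`** for the family `famAll P mbar nbar D = expansionAll P (mbar nbar) D`: δ₀ := ½δ₁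
  (first); then, given α₀ and n̄, ONE constant `O(1)(n̄) = unifO1 P (mbar n̄) = max 1 (Σ_{m ≤ mbar n̄} |Cmax|^m · m! · unifConst215 d L m δ₁)`
  — a function of `n̄` (through the size bound), `d`, `L`, `δ₁`, `Cmax` ONLY — serves every datum and EVERY graph of the expansion
  satisfying the printed hypothesis, by `Amp.bound133_total` ((2.6)/(2.7)/(2.13)/(2.15)) and the uniform bound; `prop22_uniform`.
READING (declared): n̄ bounds the perturbation order, hence the number of vertices and — through the vertex catalogue (1.6)–(1.16)
— the number of lines of the graphs of that order; in Proposition 2.2 generality (arbitrary numbers of legs) the size bound at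
level n̄ is an explicit parameter `mbar n̄` (every `mbar : ℕ → ℕ`); the vertex sets are `Fin n`, `n` arbitrary (`n ≤ 2m` occurs).
HONEST SCOPE, as in `B3Prop21Instance`: the analytic inputs (2.5), (2.10)–(2.12) are hypotheses of the class `Amp`; `Is24 := False`.
-/

open Finset

namespace Literature.MathematicalPhysics.QuantumFieldTheory.Balaban1983to89.B3Ineq213

open B3Ineq215 B3Sect2FirstEstimate B3Prop1

/-! ## Degrees are half-integers -/

section HalfIntegers

variable {V : Type} [Fintype V] [DecidableEq V] {m : ℕ}

/-- Twice the exponent contributed by the vertex `v` to the line `l`, as an integer: `−(d−2)·legs − 2·diffs + 2·avg` (cf.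
`legExpQ`). [cite: Balaban1983Higgs3, (2.14) p.427] -/
def twoLegExpZ (G : Counts V m) (v : V) (l : Fin m) : ℤ :=
  -((G.d : ℤ) - 2) * (G.legsOn v l : ℤ) - 2 * (G.diffOn v l : ℤ) + 2 * (G.vecLegAvg v l : ℤ)

/-- `2 · legExpQ` is the integer `twoLegExpZ`. [cite: Balaban1983Higgs3, (2.14) p.427] -/
theorem two_mul_legExpQ (G : Counts V m) (v : V) (l : Fin m) :
    2 * legExpQ G v l = (twoLegExpZ G v l : ℚ) := by
  unfold legExpQ twoLegExpZ
  push_cast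
  ring

/-- Twice the degree (2.2) of the block `b` of `G_i`, as an integer. [cite: Balaban1983Higgs3, (2.2) p.423] -/
noncomputable def twoDegZ (G : Counts V m) (i : ℕ) (b : V) : ℤ :=
  (∑ v ∈ G.toModel.fiber i b, (2 * (G.d : ℤ) + 2 * (G.etaPow v : ℤ))) - 2 * G.d
    + ∑ l ∈ G.toModel.before i b, ∑ v, twoLegExpZ G v l

/-- **The degrees (2.2) are half-integers**: `2·D(block) ∈ ℤ`. [cite: Balaban1983Higgs3, (2.2) p.423] -/
theorem two_mul_degQ_eq_intCast (G : Counts V m) (i : ℕ) (b : V) :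
    2 * degQ G i b = (twoDegZ G i b : ℚ) := by
  have hl : ∀ l, 2 * lineDimQ G l = ((∑ v, twoLegExpZ G v l : ℤ) : ℚ) := by
    intro l
    unfold lineDimQ
    push_cast
    rw [mul_sum]
    exact sum_congr rfl fun v _ => two_mul_legExpQ G v l
  unfold degQ twoDegZ
  push_cast
  have h1 : (2 : ℚ) * ∑ v ∈ G.toModel.fiber i b, ((G.d : ℚ) + (G.etaPow v : ℚ))
      = ∑ v ∈ G.toModel.fiber i b, (2 * (G.d : ℚ) + 2 * (G.etaPow v : ℚ)) := by
    rw [mul_sum]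
    exact sum_congr rfl fun v _ => by ring
  have h2 : (2 : ℚ) * ∑ l ∈ G.toModel.before i b, lineDimQ G l
      = ∑ l ∈ G.toModel.before i b, ((∑ v, twoLegExpZ G v l : ℤ) : ℚ) := by
    rw [mul_sum]
    exact sum_congr rfl fun l _ => hl l
  have h2' : ∑ l ∈ G.toModel.before i b, ((∑ v, twoLegExpZ G v l : ℤ) : ℚ)
      = ∑ l ∈ G.toModel.before i b, ∑ v, (twoLegExpZ G v l : ℚ) := by
    refine sum_congr rfl fun l _ => ?_
    push_cast
    rfl
  linear_combination h1 + h2 + h2'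

/-- A positive degree is at least `½` (degrees are half-integers). [cite: Balaban1983Higgs3, (2.2) p.423] -/
theorem half_le_degQ_of_pos (G : Counts V m) (i : ℕ) (b : V) (h : 0 < degQ G i b) : (1 / 2 : ℚ) ≤ degQ G i b := by
  have h2 := two_mul_degQ_eq_intCast G i b
  have hz : (0 : ℚ) < (twoDegZ G i b : ℚ) := by rw [← h2]; linarith
  have hz1 : (1 : ℤ) ≤ twoDegZ G i b := by exact_mod_cast hz
  have : (1 : ℚ) ≤ (twoDegZ G i b : ℚ) := by exact_mod_cast hz1
  linarith

/-- A positive degree of a block of the model is at least `½` (ℝ-valued form, through `cast_degQ`). [cite: Balaban1983Higgs3, (2.2) p.423] -/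
theorem half_le_D_of_pos (G : Counts V m) (i : ℕ) (b : V) (h : 0 < G.toModel.D i b) : (1 / 2 : ℝ) ≤ G.toModel.D i b := by
  rw [← cast_degQ] at h ⊢
  have hq : 0 < degQ G i b := by exact_mod_cast h
  have h1 := half_le_degQ_of_pos G i b hq
  calc (1 / 2 : ℝ) = ((1 / 2 : ℚ) : ℝ) := by norm_num
    _ ≤ ((degQ G i b : ℚ) : ℝ) := by exact_mod_cast h1

/-- If every component of `G_{i+1}` has positive degree, then `Σ_α D(G_{i+1}^{(α)}) ≥ ½` (the component containing l(i+1)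
contributes `≥ ½`, the others are positive). [cite: Balaban1983Higgs3, (2.16) p.428] -/
theorem half_le_Dsum_succ (G : Counts V m) {i : ℕ} (h : i < m)
    (hpos : ∀ b ∈ G.toModel.reps (i + 1), G.toModel.Nontriv (i + 1) b → 0 < G.toModel.D (i + 1) b) :
    (1 / 2 : ℝ) ≤ G.toModel.Dsum (i + 1) := by
  unfold Model.Dsum
  have hbs : G.toModel.bs i h ∈ (G.toModel.reps (i + 1)).filter (fun b => G.toModel.Nontriv (i + 1) b) :=
    mem_filter.2 ⟨G.toModel.bs_mem_reps_succ h, G.toModel.nontriv_succ_bs h⟩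
  calc (1 / 2 : ℝ) ≤ G.toModel.D (i + 1) (G.toModel.bs i h) :=
        half_le_D_of_pos G (i + 1) _ (hpos _ (G.toModel.bs_mem_reps_succ h) (G.toModel.nontriv_succ_bs h))
    _ ≤ ∑ b ∈ (G.toModel.reps (i + 1)).filter (fun b => G.toModel.Nontriv (i + 1) b), G.toModel.D (i + 1) b :=
        single_le_sum (f := fun b => G.toModel.D (i + 1) b)
          (fun b hb => (hpos b (mem_filter.1 hb).1 (mem_filter.1 hb).2).le) hbs

end HalfIntegers

/-! ## The constant of (2.15), uniformly in the graph -/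

section Uniform

variable {V : Type} [Fintype V] [DecidableEq V] {m : ℕ}

/-- The uniform constant of (2.15): `Π_{i<m} e^{½δ₁}K(½δ₁/(2m+1)^{i+1}, d) · ((1 − L^{−1/2})^{−1})^m` — a function of `m`, `d`, `L`,
`δ₁` only (*"O(1) depending on n̄ and δ₁ only"*). [cite: Balaban1983Higgs3, (2.15) p.427] -/
noncomputable def unifConst215 (d L m : ℕ) (δ₁ : ℝ) : ℝ :=
  (∏ i ∈ range m, Real.exp (δ₁ / 2) * Cube.Kdec (δ₁ / 2 / (2 * m + 1) ^ (i + 1)) d)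
    * ((1 - (L : ℝ) ^ (-(1 / 2 : ℝ)))⁻¹) ^ m

/-- For `L ≥ 2`: `0 < 1 − L^{−1/2}`. [cite: Balaban1983Higgs3, (2.15) p.427] -/
theorem one_sub_rpow_neg_half_pos {L : ℕ} (hL : 2 ≤ L) : 0 < 1 - (L : ℝ) ^ (-(1 / 2 : ℝ)) := by
  have hL1 : (1 : ℝ) < L := by exact_mod_cast lt_of_lt_of_le one_lt_two hL
  have : (L : ℝ) ^ (-(1 / 2 : ℝ)) < 1 := Real.rpow_lt_one_of_one_lt_of_neg hL1 (by norm_num)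
  linarith

/-- The uniform constant is positive. [cite: Balaban1983Higgs3, (2.15) p.427] -/
theorem unifConst215_pos {d L : ℕ} (hd : 0 < d) (hL : 2 ≤ L) (m : ℕ) {δ₁ : ℝ} (hδ : 0 < δ₁) :
    0 < unifConst215 d L m δ₁ := by
  unfold unifConst215
  refine mul_pos (prod_pos fun i _ => mul_pos (Real.exp_pos _) (Cube.Kdec_pos ?_ hd)) ?_
  · have : (0 : ℝ) < (2 * m + 1 : ℝ) ^ (i + 1) := by positivity
    exact div_pos (half_pos hδ) this
  · exact pow_pos (inv_pos.2 (one_sub_rpow_neg_half_pos hL)) _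

/-- The first factor of `const215` IS the first factor of the uniform constant. [cite: Balaban1983Higgs3, (2.15) p.427] -/
theorem prod_Kst_eq (G : Counts V m) :
    ∏ i ∈ range m, G.toModel.Kst i = ∏ i ∈ range m, Real.exp (G.δ₁ / 2) * Cube.Kdec (G.δ₁ / 2 / (2 * m + 1) ^ (i + 1)) G.d :=
  rfl

/-- Under `Σ_α D(G_{i+1}^{(α)}) ≥ ½` the ratio of (2.16) is at most `L^{−1/2}`. [cite: Balaban1983Higgs3, (2.16) p.428] -/
theorem rho215_le (G : Counts V m) {i : ℕ} (h : (1 / 2 : ℝ) ≤ G.toModel.Dsum (i + 1)) :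
    G.toModel.rho215 i ≤ (G.L : ℝ) ^ (-(1 / 2 : ℝ)) := by
  unfold Model.rho215
  exact Real.rpow_le_rpow_of_exponent_le G.toModel.one_lt_L.le (by linarith)

/-- **The constant of (2.15) is uniform in the graph**: if every component of every `G_i` has positive degree, then
`const215(G) ≤ unifConst215 d L m δ₁`. [cite: Balaban1983Higgs3, (2.15) p.427] -/
theorem const215_le_unifConst215 (G : Counts V m)
    (hpos : ∀ i, i ≤ m → ∀ b ∈ G.toModel.reps i, G.toModel.Nontriv i b → 0 < G.toModel.D i b) :
    G.toModel.const215 ≤ unifConst215 G.d G.L m G.δ₁ := by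
  unfold Model.const215 unifConst215
  rw [prod_Kst_eq]
  have hq : 0 < 1 - (G.L : ℝ) ^ (-(1 / 2 : ℝ)) := one_sub_rpow_neg_half_pos G.two_le_L
  have hK : 0 ≤ ∏ i ∈ range m, Real.exp (G.δ₁ / 2) * Cube.Kdec (G.δ₁ / 2 / (2 * m + 1) ^ (i + 1)) G.d := by
    rw [← prod_Kst_eq]
    exact prod_nonneg fun i _ => (G.toModel.Kst_pos i).le
  refine mul_le_mul_of_nonneg_left ?_ hK
  calc ∏ i ∈ range m, (1 - G.toModel.rho215 i)⁻¹
      ≤ ∏ _i ∈ range m, (1 - (G.L : ℝ) ^ (-(1 / 2 : ℝ)))⁻¹ := by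
        refine prod_le_prod (fun i hi => ?_) (fun i hi => ?_)
        · have hi' : i < m := mem_range.1 hi
          have := G.toModel.rho215_lt_one (G.toModel.Dsum_succ_pos hi' (hpos (i + 1) hi'))
          exact inv_nonneg.2 (by linarith)
        · have hi' : i < m := mem_range.1 hi
          have hρ := rho215_le G (half_le_Dsum_succ G hi' (hpos (i + 1) hi'))
          exact inv_anti₀ hq (by linarith)
    _ = ((1 - (G.L : ℝ) ^ (-(1 / 2 : ℝ)))⁻¹) ^ m := by rw [prod_const, card_range]

/-- The same bound for the graph relabeled along an ordering l̃ (relabeling keeps `d`, `L`, `δ₁`, `m`). [cite: Balaban1983Higgs3, (2.7) p.425] -/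
theorem const215_relabel_le (G : Counts V m) (σ : Equiv.Perm (Fin m))
    (hpos : ∀ i, i ≤ m → ∀ b ∈ (relabelCounts G σ).toModel.reps i, (relabelCounts G σ).toModel.Nontriv i b →
      0 < (relabelCounts G σ).toModel.D i b) :
    (relabelCounts G σ).toModel.const215 ≤ unifConst215 G.d G.L m G.δ₁ :=
  const215_le_unifConst215 (relabelCounts G σ) hpos

/-- Summed over the `m!` orderings: `Σ_{l̃} const215(G along l̃) ≤ m! · unifConst215 d L m δ₁`. [cite: Balaban1983Higgs3, (2.7) p.425] -/
theorem sum_const215_le (G : Counts V m)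
    (hpos : ∀ σ : Equiv.Perm (Fin m), ∀ i, i ≤ m → ∀ b ∈ (relabelCounts G σ).toModel.reps i,
      (relabelCounts G σ).toModel.Nontriv i b → 0 < (relabelCounts G σ).toModel.D i b) :
    ∑ σ : Equiv.Perm (Fin m), (relabelCounts G σ).toModel.const215 ≤ (m.factorial : ℝ) * unifConst215 G.d G.L m G.δ₁ := by
  calc ∑ σ : Equiv.Perm (Fin m), (relabelCounts G σ).toModel.const215
      ≤ ∑ _σ : Equiv.Perm (Fin m), unifConst215 G.d G.L m G.δ₁ := sum_le_sum fun σ _ => const215_relabel_le G σ (hpos σ)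
    _ = (m.factorial : ℝ) * unifConst215 G.d G.L m G.δ₁ := by
        rw [sum_const, card_univ, Fintype.card_perm, Fintype.card_fin, nsmul_eq_mul]

end Uniform

/-! ## The multi-graph expansion: all count data of bounded size, one expansion per analytic datum -/

/-- The constants fixed for a family of expansions: the lattice constants `d`, `L`, the decay rate `δ₁` of (2.10) (so that
δ₀ = ½δ₁ *"depends on the dimension d only"* — here: on the fixed lattice data only), and the bound `Cmax` on the constants O(1)
of (2.10)–(2.12). [cite: Balaban1983Higgs3, Prop. 1 p.421] -/
structure Params where
  /-- dimension -/
  d : ℕ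
  /-- block size -/
  L : ℕ
  /-- decay rate δ₁ of (2.10) -/
  δ₁ : ℝ
  /-- bound on the kernel constants O(1) of (2.10)–(2.12) -/
  Cmax : ℝ
  d_pos : 0 < d
  two_le_L : 2 ≤ L
  δ₁_pos : 0 < δ₁

/-- The graphs of the expansion at the size bound `mb`: all count data on the vertex sets `Fin n` with `m ≤ mb` lines and the
lattice constants of `P`. [cite: Balaban1983Higgs3, Prop. 2.1 p.424] -/
structure CGraph (P : Params) (mb : ℕ) where
  /-- number of vertices -/
  n : ℕ
  /-- number of lines -/
  m : ℕ
  m_le : m ≤ mb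
  /-- the count datum -/
  G : Counts (Fin n) m
  d_eq : G.d = P.d
  L_eq : G.L = P.L
  δ₁_eq : G.δ₁ = P.δ₁

/-- The analytic datum of one expansion (the model's *"ε, k, the domains Ω, Ω₁, Ω₂, the vector field B̃"*): the number `k` of
completed steps, the running couplings `e(L^kε) > 0`, `λ(L^kε) > 0`, and for every count datum the localized lattice graph
amplitude of that graph (vertex functions, line kernels, constants `≤ Cmax`, orders, norms) at these values.
[cite: Balaban1983Higgs3, Prop. 1 p.421] -/
structure Datum (P : Params) where
  /-- number of completed renormalization steps -/
  k : ℕ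
  /-- `e(L^kε)` -/
  eRun : ℝ
  /-- `λ(L^kε)` -/
  lamRun : ℝ
  eRun_pos : 0 < eRun
  lamRun_pos : 0 < lamRun
  /-- the amplitude of each graph -/
  amp : ∀ {n m : ℕ} (G : Counts (Fin n) m), Amp G.toModel
  amp_k : ∀ {n m : ℕ} (G : Counts (Fin n) m), (amp G).k = k
  amp_eRun : ∀ {n m : ℕ} (G : Counts (Fin n) m), (amp G).eRun = eRun
  amp_lamRun : ∀ {n m : ℕ} (G : Counts (Fin n) m), (amp G).lamRun = lamRun
  /-- the constants O(1) of (2.10)–(2.12) are bounded by `Cmax` -/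
  amp_C_le : ∀ {n m : ℕ} (G : Counts (Fin n) m) (l : Fin m), (amp G).C l ≤ P.Cmax

/-- **The multi-graph expansion of r15's carrier `B3Prop1.GraphExpansion`** for the analytic datum `D` at the size bound `mb`:
renormalized classes = graphs = `CGraph P mb` (the one-element classes `{G}` of Prop. 2.1), localizations of `G` = its unit cubes
`{□(v)}`, `E({G}, {□(v)}, ·, ·)` = the total amplitude `Amp.Etot` of `G` at those cubes, `d({□(v)})` = `boxTreeLen`, norms = `Π_v N^Φ_v`,
`Π_v N^A_v`, orders `d_v(G) = Σ_v d_v(v)`, `d_s(G) = Σ_v d_s(v)`, connected subgraphs = the components of the `G_i` along every ordering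
(`Component`) with their degrees `degQ`, `Is24 := False`. [cite: Balaban1983Higgs3, Prop. 2.1 p.424] -/
noncomputable def expansionAll (P : Params) (mb : ℕ) (D : Datum P) : GraphExpansion where
  eRun := D.eRun
  lamRun := D.lamRun
  eRun_pos := D.eRun_pos
  lamRun_pos := D.lamRun_pos
  RenClass := CGraph P mb
  Loc := fun G => Fin G.n → Fin G.G.toModel.d → ℕ
  ExtS := Unit
  ExtV := Unit
  E := fun G box _ _ => ((D.amp G.G).withBox box).Etot
  ds := fun G => ∑ v, (D.amp G.G).ds v
  dv := fun G => ∑ v, (D.amp G.G).dv v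
  treeLen := fun G box => boxTreeLen G.G.L (D.amp G.G).k box
  treeLen_nonneg := fun G box => boxTreeLen_nonneg G.G.L (D.amp G.G).k box
  normS := fun _ G _ _ => ∏ v, (D.amp G.G).NPhi v
  normV := fun _ G _ _ => ∏ v, (D.amp G.G).NA v
  normS_nonneg := fun _ G _ _ => prod_nonneg fun v _ => (D.amp G.G).NPhi_nonneg v
  normV_nonneg := fun _ G _ _ => prod_nonneg fun v _ => (D.amp G.G).NA_nonneg v
  Graph := CGraph P mb
  single := id
  Connected := fun _ => True
  Sub := fun G => Component G.G
  subDeg := fun G H => degQ (relabelCounts G.G H.1) H.2.1 H.2.2.1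
  Is24 := fun _ _ => False

/-- The family `fam n̄ D` of r15's `Prop21`: at level `n̄` the graphs have at most `mbar n̄` lines. [cite: Balaban1983Higgs3, Prop. 2.1 p.424] -/
noncomputable def famAll (P : Params) (mbar : ℕ → ℕ) : ℕ → Datum P → GraphExpansion := fun nbar D => expansionAll P (mbar nbar) D

/-- The printed hypothesis, read on the multi-graph expansion: `PosSubgraphsExcept24` for the graph `G` says that every component
of every `G_i` along every ordering has positive (ℝ-valued) degree — the hypothesis of `Amp.bound133_total`. [cite: Balaban1983Higgs3, Prop. 2.1 p.424] -/
theorem hpos_of_posSubgraphs_all {P : Params} {mb : ℕ} {D : Datum P} {G : CGraph P mb}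
    (h : PosSubgraphsExcept24 (expansionAll P mb D) G) (σ : Equiv.Perm (Fin G.m)) :
    ∀ i, i ≤ G.m → ∀ b ∈ (relabelCounts G.G σ).toModel.reps i, (relabelCounts G.G σ).toModel.Nontriv i b →
      0 < (relabelCounts G.G σ).toModel.D i b := by
  intro i hi b hb hn
  have h' := h.2 ⟨σ, ⟨i, Nat.lt_succ_of_le hi⟩, ⟨b, hb, hn⟩⟩
  rcases h' with h0 | hpos
  · exact (h0 : False).elim
  · have hc := cast_degQ (relabelCounts G.G σ) i b
    have : (0 : ℝ) < ((degQ (relabelCounts G.G σ) i b : ℚ) : ℝ) := by exact_mod_cast hpos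
    rw [hc] at this
    exact this

/-- The per-size term of the uniform constant: `|Cmax|^m · m! · unifConst215 d L m δ₁`. [cite: Balaban1983Higgs3, Prop. 1 p.421] -/
noncomputable def sizeTerm (P : Params) (m : ℕ) : ℝ := |P.Cmax| ^ m * ((m.factorial : ℝ) * unifConst215 P.d P.L m P.δ₁)

/-- `sizeTerm ≥ 0`. [cite: Balaban1983Higgs3, Prop. 1 p.421] -/
theorem sizeTerm_nonneg (P : Params) (m : ℕ) : 0 ≤ sizeTerm P m :=
  mul_nonneg (pow_nonneg (abs_nonneg _) _)
    (mul_nonneg (Nat.cast_nonneg _) (unifConst215_pos P.d_pos P.two_le_L m P.δ₁_pos).le)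

/-- **The uniform constant O(1)(n̄)** at the size bound `mb`: `max 1 (Σ_{m ≤ mb} |Cmax|^m · m! · unifConst215 d L m δ₁)` — depends on
`mb`, `d`, `L`, `δ₁`, `Cmax` only. [cite: Balaban1983Higgs3, Prop. 1 p.421] -/
noncomputable def unifO1 (P : Params) (mb : ℕ) : ℝ := max 1 (∑ m ∈ range (mb + 1), sizeTerm P m)

/-- `unifO1 > 0`. [cite: Balaban1983Higgs3, Prop. 1 p.421] -/
theorem unifO1_pos (P : Params) (mb : ℕ) : 0 < unifO1 P mb := lt_max_of_lt_left one_pos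

/-- Each size term is dominated by the uniform constant. [cite: Balaban1983Higgs3, Prop. 1 p.421] -/
theorem sizeTerm_le_unifO1 (P : Params) {mb m : ℕ} (hm : m ≤ mb) : sizeTerm P m ≤ unifO1 P mb :=
  (single_le_sum (f := sizeTerm P) (fun m _ => sizeTerm_nonneg P m) (mem_range.2 (Nat.lt_succ_of_le hm))).trans
    (le_max_right _ _)

/-- The product of the kernel constants of a graph with `m` lines is at most `|Cmax|^m`. [cite: Balaban1983Higgs3, (2.13) p.426] -/
theorem prod_C_le_abs_pow {P : Params} (D : Datum P) {n m : ℕ} (G : Counts (Fin n) m) :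
    ∏ l, (D.amp G).C l ≤ |P.Cmax| ^ m := by
  calc ∏ l, (D.amp G).C l ≤ ∏ _l : Fin m, |P.Cmax| :=
        prod_le_prod (fun l _ => (D.amp G).C_nonneg l) fun l _ => (D.amp_C_le G l).trans (le_abs_self _)
    _ = |P.Cmax| ^ m := by rw [prod_const, card_univ, Fintype.card_fin]

/-- **Proposition 2.1 with a uniform constant — r15's `B3Prop1.Prop21` INHABITED for the multi-graph expansions**: with `δ₀ := ½δ₁`
(chosen first) and, given α₀ and n̄, the single constant `O(1)(n̄) := unifO1 P (mbar n̄)` (chosen before the datum, a function of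
`n̄`, `d`, `L`, `δ₁`, `Cmax` only), (1.33) holds for the class `{G}` of EVERY graph with at most `mbar n̄` lines all of whose components
(of the `G_i`, every ordering) have positive degree, for every analytic datum, all unit cubes and all external-field data.
[cite: Balaban1983Higgs3, Prop. 2.1 p.424] -/
theorem prop21_uniform (P : Params) (mbar : ℕ → ℕ) : Prop21 (famAll P mbar) := by
  classical
  refine ⟨P.δ₁ / 2, half_pos P.δ₁_pos, fun α₀ _ _ nbar => ?_⟩
  refine ⟨unifO1 P (mbar nbar), unifO1_pos P (mbar nbar), fun D G hG => ?_⟩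
  intro box Φ Aext
  set A : Amp G.G.toModel := (D.amp G.G).withBox box with hA
  have hpos := fun σ => hpos_of_posSubgraphs_all hG σ
  have hmain := A.bound133_total hpos
  have hC : ∏ l, A.C l ≤ |P.Cmax| ^ G.m := prod_C_le_abs_pow D G.G
  have hS : ∑ σ : Equiv.Perm (Fin G.m), (relabelCounts G.G σ).toModel.const215
      ≤ (G.m.factorial : ℝ) * unifConst215 P.d P.L G.m P.δ₁ := by
    have := sum_const215_le G.G hpos
    rw [G.d_eq, G.L_eq, G.δ₁_eq] at this
    exact this
  have hS0 : 0 ≤ ∑ σ : Equiv.Perm (Fin G.m), (relabelCounts G.G σ).toModel.const215 :=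
    sum_nonneg fun σ _ => ((relabelCounts G.G σ).toModel.const215_pos fun i hi =>
      (relabelCounts G.G σ).toModel.Dsum_succ_pos hi (hpos σ (i + 1) hi)).le
  have hK : (∏ l, A.C l) * ∑ σ : Equiv.Perm (Fin G.m), (relabelCounts G.G σ).toModel.const215 ≤ unifO1 P (mbar nbar) :=
    calc (∏ l, A.C l) * ∑ σ : Equiv.Perm (Fin G.m), (relabelCounts G.G σ).toModel.const215
        ≤ |P.Cmax| ^ G.m * ((G.m.factorial : ℝ) * unifConst215 P.d P.L G.m P.δ₁) :=
          mul_le_mul hC hS hS0 (pow_nonneg (abs_nonneg _) _)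
      _ = sizeTerm P G.m := rfl
      _ ≤ unifO1 P (mbar nbar) := sizeTerm_le_unifO1 P G.m_le
  have hpref : 0 ≤ A.pref := A.pref_nonneg
  -- assemble in the shape of `Ineq133At`
  show |A.Etot| ≤ unifO1 P (mbar nbar) * D.eRun ^ (∑ v, (D.amp G.G).dv v) * D.lamRun ^ (∑ v, (D.amp G.G).ds v)
      * Real.exp (-(P.δ₁ / 2 * boxTreeLen G.G.L (D.amp G.G).k box))
      * (∏ v, (D.amp G.G).NPhi v) * (∏ v, (D.amp G.G).NA v)
  have e : A.pref = D.eRun ^ (∑ v, (D.amp G.G).dv v) * D.lamRun ^ (∑ v, (D.amp G.G).ds v)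
      * Real.exp (-(P.δ₁ / 2 * boxTreeLen G.G.L (D.amp G.G).k box))
      * (∏ v, (D.amp G.G).NPhi v) * (∏ v, (D.amp G.G).NA v) := by
    rw [hA, ← D.amp_eRun G.G, ← D.amp_lamRun G.G, ← G.δ₁_eq]
    rfl
  have e' : unifO1 P (mbar nbar) * D.eRun ^ (∑ v, (D.amp G.G).dv v) * D.lamRun ^ (∑ v, (D.amp G.G).ds v)
      * Real.exp (-(P.δ₁ / 2 * boxTreeLen G.G.L (D.amp G.G).k box))
      * (∏ v, (D.amp G.G).NPhi v) * (∏ v, (D.amp G.G).NA v)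
      = unifO1 P (mbar nbar) * A.pref := by
    rw [e]; ring
  rw [e']
  calc |A.Etot| ≤ (∏ l, A.C l) * (∑ σ : Equiv.Perm (Fin G.m), (relabelCounts G.G σ).toModel.const215) * A.pref := hmain
    _ ≤ unifO1 P (mbar nbar) * A.pref := mul_le_mul_of_nonneg_right hK hpref

/-- The same family inhabits r15's `B3Prop1.Prop22` (the amplitudes ARE in Proposition 2.2 generality). [cite: Balaban1983Higgs3, Prop. 2.2 p.428] -/
theorem prop22_uniform (P : Params) (mbar : ℕ → ℕ) : Prop22 (famAll P mbar) :=
  prop21_uniform P mbar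

end Literature.MathematicalPhysics.QuantumFieldTheory.Balaban1983to89.B3Ineq213
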